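import Summits.AtomisticToContinuum.Crystallization.Theorems.ChargedEnergyGapBarlowCount
import HarnessLib

/-!
# Charged energy gap — lens-3 g64, node «BarlowRef» (R3) — part 6: the CORED (half-space) and LEVEL-LOCALISED forms of the tube-load target

ELEMENTARY·PROVED bookkeeping + two typed `Prop` slots refining the prover target `TubeShareBound` of part 3 (§R10) by the two pieces of
structure the block scheme P-Z₅d actually has (memo g64 §3; calibration `num/patch64.py|.out`, continuum, dense corner `ρ = 2.157`, `r_b = 18`):

* §R11 `TubeShareBoundH s r ϱ ℓ b₀ R θ` — the CORED share bound: a CORE POINT `x₀` with the member `c` within `ℓ` of it (`ℓ = 159`: level of a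
  block member `≤ 159`) and every source OUTSIDE `B̄(x₀, ϱ)` (`ϱ = 160`: bulk sources have `infDist(·, C) ≥ ϱ`, so they avoid the `ϱ`-ball of every
  core point), targets `≥ b₀` from the member AND from every source (`b₀ = 3ϱ/8 = 60`: the tree's far targets `X ∖ nearZone` are `≥ 60` from every
  alive paying site).  `tubeShareBoundH_of_tubeShareBound` (the isotropic form with `a₀ = ϱ − ℓ` implies it), `.mono`.
  WHY: with sources all around the member (the isotropic kernel behind `TubeShareBound … 1 60 …`) the continuum worst ratio is `0.22` exact /
  `0.52` certified — the small-angle closed form `4π²r²ρ²/(6(a₀+b₀)²)` of memo §1 UNDER-counts sources inside the tube ball by `×1.8`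
  (`num/inside64.out`); with the sources confined outside the core ball (this form) it is `0.11` exact / `0.26` certified at the worst (top-level)
  member and `0.013–0.06` for members at levels `122–145` (`num/patch64.out`, columns `tube_T4`).  This is the form the registered census test measures.
* §R12 `patchLoad r ℓ₁ c x₀ F G` — the LEVEL-LOCALISED kernel: the pair `(y,z)` counts only if its segment has a point `p` with `dist p c ≤ r` AND
  `dist p x₀ ≤ ℓ₁` (`ℓ₁ = 142.2`: the pair is charged at its chain site `q_t` of level `≤ 141`, which is within `1` of the segment and within `141.2`
  of a core point); `patchLoad_le_tubeLoad`, `PatchShareBound`, `patchShareBound_of_tubeShareBoundH`, and the two metric facts the prover uses: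
  `le_dist_of_cored` (`ϱ − ℓ₁ ≤ dist y p`) and `dist_eq_of_mem_segment_patch` (`dist y z = dist y p + dist p z ≥ (ϱ − ℓ₁) + dist p z`).
  Calibration: worst member (level 140) `0.016` exact / `0.038` certified; top members `0.002–0.008` (columns `patch_T4`) — a `×6` reserve lever,
  valid per block with ONE core point (a member shared by blocks with different core points needs the per-block Fubini; memo §3).

0 sorry; standard axioms.
-/

noncomputable section

open scoped Classical
open Literature.MathematicalPhysics.StatisticalMechanics Literature.Geometry.DiscreteGeometry
open Summit.AtomisticToContinuum.Crystallization.Theses.PricedLinkCensus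
open Summit.AtomisticToContinuum.Crystallization.Theorems.ChargedEnergyGapNegative

namespace Summit.AtomisticToContinuum.Crystallization.Theorems.ChargedEnergyGapChartDial

section TubeH

/-- Reverse triangle inequality in the cored geometry: a member within `ℓ` of the core point and a source outside its `ϱ`-ball are `≥ ϱ − ℓ` apart. -/
theorem le_dist_of_cored {x₀ c y : E3} {ϱ ℓ : ℝ} (hc : dist c x₀ ≤ ℓ) (hy : ϱ ≤ dist y x₀) : ϱ - ℓ ≤ dist y c := by
  have := dist_triangle y c x₀
  linarith

/-- piece TUBE-SHARE-H(`r`, `ϱ`, `ℓ`, `b₀`; `R`, `θ`) · UNDECIDED (TRUE with slack ≈ ×4 at the record dials, `num/patch64.out`) · ATTACKABLE·S–M ·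
**THE CORED SHARE BOUND**: for every `s`-separated Barlow-image reference, every core point `x₀`, member `c` with `dist c x₀ ≤ ℓ`, site `q`,
sources `F` outside `B̄(x₀, ϱ)` and targets `G` at distance `≥ b₀` from `c` and from every source: `tubeLoad r c F G ≤ θ · #(P.points ∩ B̄(q, R))`. -/
def TubeShareBoundH (s r ϱ ℓ b₀ R θ : ℝ) : Prop :=
  ∀ P : PeriodicConfiguration 3, IsSeparatedRef s P → IsBarlowImage P.points →
    ∀ (x₀ c q : E3) (F G : Finset E3), (↑F : Set E3) ⊆ P.points → (↑G : Set E3) ⊆ P.points → q ∈ P.points →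
      dist c x₀ ≤ ℓ → (∀ y ∈ F, ϱ ≤ dist y x₀) → (∀ z ∈ G, b₀ ≤ dist z c) → (∀ y ∈ F, ∀ z ∈ G, b₀ ≤ dist y z) →
      tubeLoad r c F G ≤ θ * ((P.points ∩ Metric.closedBall q R).ncard : ℝ)

/-- The isotropic share bound with `a₀ = ϱ − ℓ` implies the cored one (it ignores the core ball and the pairwise separation). -/
theorem tubeShareBoundH_of_tubeShareBound {s r ϱ ℓ b₀ R θ : ℝ} (h : TubeShareBound s r (ϱ - ℓ) b₀ R θ) : TubeShareBoundH s r ϱ ℓ b₀ R θ :=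
  fun P hsep hB _ c q F G hF hG hq hc hFo hGb _ =>
    h P hsep hB c q F G hF hG hq (fun y hy => le_dist_of_cored hc (hFo y hy)) hGb

/-- Monotonicity of the cored share bound: smaller tube, larger core radius, smaller member level, larger target distance, larger count
radius, larger `θ`. [formal bookkeeping] -/
theorem TubeShareBoundH.mono {s r ϱ ℓ b₀ R θ r' ϱ' ℓ' b₀' R' θ' : ℝ} (hs : 0 < s) (hr : r' ≤ r) (hϱ : ϱ ≤ ϱ') (hℓ : ℓ' ≤ ℓ) (hb : b₀ ≤ b₀')
    (hR : R ≤ R') (hθ : θ ≤ θ') (hθ0 : 0 ≤ θ) (h : TubeShareBoundH s r ϱ ℓ b₀ R θ) : TubeShareBoundH s r' ϱ' ℓ' b₀' R' θ' := by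
  intro P hsep hB x₀ c q F G hF hG hq hc hFo hGb hFG
  have hfin : (P.points ∩ Metric.closedBall q R').Finite := hsep.finite_inter_closedBall hs q R'
  have hcnt : ((P.points ∩ Metric.closedBall q R).ncard : ℝ) ≤ ((P.points ∩ Metric.closedBall q R').ncard : ℝ) := by
    exact_mod_cast Set.ncard_le_ncard (Set.inter_subset_inter_right _ (Metric.closedBall_subset_closedBall hR)) hfin
  calc tubeLoad r' c F G ≤ tubeLoad r c F G := tubeLoad_mono hr c F G
    _ ≤ θ * ((P.points ∩ Metric.closedBall q R).ncard : ℝ) :=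
        h P hsep hB x₀ c q F G hF hG hq (hc.trans hℓ) (fun y hy => hϱ.trans (hFo y hy)) (fun z hz => hb.trans (hGb z hz))
          fun y hy z hz => hb.trans (hFG y hy z hz)
    _ ≤ θ' * ((P.points ∩ Metric.closedBall q R').ncard : ℝ) :=
        (mul_le_mul_of_nonneg_left hcnt hθ0).trans (mul_le_mul_of_nonneg_right hθ (Nat.cast_nonneg _))

/-- **THE LEVEL-LOCALISED (PATCH) LOAD** on the member `c` with core point `x₀`: the pair `(y, z)` counts iff some point `p` of its segment has
`dist p c ≤ r` and `dist p x₀ ≤ ℓ₁`; weight `(dist y z)⁻⁶`. -/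
def patchLoad (r ℓ₁ : ℝ) (c x₀ : E3) (F G : Finset E3) : ℝ :=
  ∑ y ∈ F, ∑ z ∈ G, if y ≠ z ∧ ∃ p ∈ segment ℝ y z, dist p c ≤ r ∧ dist p x₀ ≤ ℓ₁ then (dist y z)⁻¹ ^ 6 else 0

/-- The patch load is non-negative. -/
theorem patchLoad_nonneg (r ℓ₁ : ℝ) (c x₀ : E3) (F G : Finset E3) : 0 ≤ patchLoad r ℓ₁ c x₀ F G :=
  Finset.sum_nonneg fun _ _ => Finset.sum_nonneg fun _ _ => by split_ifs <;> positivity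

/-- ★ The patch load is dominated by the tube load (a witness point within `r` of `c` puts the segment within `r`). -/
theorem patchLoad_le_tubeLoad (r ℓ₁ : ℝ) (c x₀ : E3) (F G : Finset E3) : patchLoad r ℓ₁ c x₀ F G ≤ tubeLoad r c F G := by
  refine Finset.sum_le_sum fun y _ => Finset.sum_le_sum fun z _ => ?_
  by_cases h1 : y ≠ z ∧ ∃ p ∈ segment ℝ y z, dist p c ≤ r ∧ dist p x₀ ≤ ℓ₁
  · obtain ⟨hne, p, hp, hpc, _⟩ := h1
    have h2 : y ≠ z ∧ Metric.infDist c (segment ℝ y z) ≤ r :=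
      ⟨hne, (Metric.infDist_le_dist_of_mem hp).trans (by rwa [dist_comm])⟩
    rw [if_pos ⟨hne, p, hp, hpc, ‹_›⟩, if_pos h2]
  · rw [if_neg h1]
    split_ifs <;> positivity

/-- The patch load is monotone in both radii. -/
theorem patchLoad_mono {r r' ℓ₁ ℓ₁' : ℝ} (hr : r ≤ r') (hℓ : ℓ₁ ≤ ℓ₁') (c x₀ : E3) (F G : Finset E3) :
    patchLoad r ℓ₁ c x₀ F G ≤ patchLoad r' ℓ₁' c x₀ F G := by
  refine Finset.sum_le_sum fun y _ => Finset.sum_le_sum fun z _ => ?_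
  by_cases h1 : y ≠ z ∧ ∃ p ∈ segment ℝ y z, dist p c ≤ r ∧ dist p x₀ ≤ ℓ₁
  · obtain ⟨hne, p, hp, hpc, hpx⟩ := h1
    rw [if_pos ⟨hne, p, hp, hpc, hpx⟩, if_pos ⟨hne, p, hp, hpc.trans hr, hpx.trans hℓ⟩]
  · rw [if_neg h1]
    split_ifs <;> positivity

/-- ★ The metric gain of the localisation: a segment point `p` within `ℓ₁` of the core point is `≥ ϱ − ℓ₁` from a source outside the core
`ϱ`-ball, and then `dist y z = dist y p + dist p z ≥ (ϱ − ℓ₁) + dist p z`. -/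
theorem dist_ge_of_mem_segment_patch {x₀ y z p : E3} {ϱ ℓ₁ : ℝ} (hp : p ∈ segment ℝ y z) (hy : ϱ ≤ dist y x₀) (hpx : dist p x₀ ≤ ℓ₁) :
    ϱ - ℓ₁ + dist p z ≤ dist y z := by
  have h1 : ϱ - ℓ₁ ≤ dist y p := le_dist_of_cored hpx hy
  have h2 : dist y p + dist p z = dist y z := dist_add_dist_of_mem_segment hp
  linarith

/-- piece PATCH-SHARE(`r`, `ϱ`, `ℓ`, `ℓ₁`, `b₀`; `R`, `θ`) · UNDECIDED (TRUE with slack ≈ ×25 at the record dials, `num/patch64.out`) · ATTACKABLE·M ·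
**THE LEVEL-LOCALISED SHARE BOUND** (same hypotheses as `TubeShareBoundH`, conclusion with `patchLoad r ℓ₁ c x₀`). -/
def PatchShareBound (s r ϱ ℓ ℓ₁ b₀ R θ : ℝ) : Prop :=
  ∀ P : PeriodicConfiguration 3, IsSeparatedRef s P → IsBarlowImage P.points →
    ∀ (x₀ c q : E3) (F G : Finset E3), (↑F : Set E3) ⊆ P.points → (↑G : Set E3) ⊆ P.points → q ∈ P.points →
      dist c x₀ ≤ ℓ → (∀ y ∈ F, ϱ ≤ dist y x₀) → (∀ z ∈ G, b₀ ≤ dist z c) → (∀ y ∈ F, ∀ z ∈ G, b₀ ≤ dist y z) →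
      patchLoad r ℓ₁ c x₀ F G ≤ θ * ((P.points ∩ Metric.closedBall q R).ncard : ℝ)

/-- The cored tube bound implies the patch bound with the same constant (the localisation only discards pairs). -/
theorem patchShareBound_of_tubeShareBoundH {s r ϱ ℓ ℓ₁ b₀ R θ : ℝ} (h : TubeShareBoundH s r ϱ ℓ b₀ R θ) : PatchShareBound s r ϱ ℓ ℓ₁ b₀ R θ :=
  fun P hsep hB x₀ c q F G hF hG hq hc hFo hGb hFG =>
    (patchLoad_le_tubeLoad r ℓ₁ c x₀ F G).trans (h P hsep hB x₀ c q F G hF hG hq hc hFo hGb hFG)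

/-- RECORD DIALS (memo g64 §3): core radius `ϱ = 160`, member level `ℓ = 159`, patch level `ℓ₁ = 142.2 = 711/5`, far split `b₀ = 3ϱ/8 = 60`,
tube radius `r = r_b + 6/5 + 1 = 101/5` (block radius `18`, passage step `6/5`, chain-to-segment offset `1`), count radius `R = r_b = 18`;
the implied source distance `ϱ − ℓ = 1` and level gap `ϱ − ℓ₁ = 89/5 = 17.8`. -/
theorem record_tubeH_dials : (160 : ℝ) - 159 = 1 ∧ (160 : ℝ) - 711 / 5 = 89 / 5 ∧ (3 : ℝ) * 160 / 8 = 60 ∧ (18 : ℝ) + 6 / 5 + 1 = 101 / 5 := by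
  norm_num

end TubeH

end Summit.AtomisticToContinuum.Crystallization.Theorems.ChargedEnergyGapChartDial

end
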